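import Literature.AlgebraicGeometry.AbelianSchemes.PoincarePullbackKernelCountComplex
import Literature.AlgebraicGeometry.AbelianSchemes.PoincarePullbackKernelCountOfQuotient
import Literature.AlgebraicGeometry.Motives.AbelianVarietyEtaleIsogenyGeometricQuotient
import Literature.AlgebraicGeometry.Limits.SurjectiveSpread
import HarnessLib

/-!
# `#{b ∈ Â_t(Ω) : π_t^*𝒫_b ≅ 𝒪} ≤ #ker π_t(Ω)` and `#T_t · #K ≤ n^{2g}` at a GEOMETRIC point of any characteristic
# ([MumfordAV1970] §15 Thm. 1, injectivity half; §7 Thm. 4; §6 App. 3) — the characteristic-free twin of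
# ★ `PoincarePullbackKernelCountComplex` + ★ `PoincarePullbackKernelCountOfQuotient` §3

Layer `Literature/AlgebraicGeometry/AbelianSchemes`, namespaces `Literature.AlgebraicGeometry.AbelianSchemes.AbelianSchemeOver(.DualPair)`.
THEOREMS ONLY (no definition, no named fact, no instance, no notation, no `sorry`).  Same currency as the two ★ files, with the
complex point `t : Spec ℂ → S` replaced by a geometric point `t : Spec Ω → S`, `Ω` ANY algebraically closed field (e.g.
`Ω = κ̄(w)` in characteristic `p`), under the one hypothesis that is invisible over `ℂ`: the isogeny `π_t` must be ÉTALE (for an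
inseparable `π_t` the count is false: `#ker F̂ = p > 1 = #ker F(Ω)` on an ordinary elliptic curve).  For `π = mulNDesc : A/K → A`
with `ψ ≫ π = [n]` and `(n : Ω) ≠ 0` this is automatic (§3).

* §1 **`DualPair.finite_and_ncard_le_natCard_kerPoints_of_etale`** — for a homomorphism `π : X → A` of abelian schemes, a dual
  pair `D = (Â, 𝒫)` of `A`, `N := (π × 1_Â)^*𝒫`, and a geometric point `t` at which `π_t` is an ÉTALE isogeny: the set
  `T_t := {b ∈ Â_t(Ω) | (1_X × b)^*N ≅ 𝒪}` is finite with `#T_t ≤ #ker π_t(Ω)`.  The ★ complex proof VERBATIM (descent of the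
  unit along the free affine flat geometric quotient `π_t`, eigenvalue characters + Dedekind: ★
  `DescentOfUnitCharacterCount.finite_and_natCard_le_card_of_forall_iso`; Stein ★ `appTop_bijective_of_isReduced`; point-injectivity
  of the dual pair ★ `eq_of_nonempty_iso`), with «`π_t` is a geometric quotient by `Ker π_t(Ω)`» now supplied CHARACTERISTIC-FREE by
  ★ `AbelianVariety.isGeometricQuotient_kerTranslationActionOver_of_etale` ([SGA1] V Prop. 2.6) instead of the complex recognition
  theorem.
* §2 `natCard_kerPoints_fibreHom_mulNDesc_mul_natCard_geometric` — `#ker π_t(Ω) · #K = n^{2g}` for `π = mulNDesc`, `A/S` of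
  relative dimension `g`, `(n : Ω) ≠ 0` (★ `IsIsogeny.natCard_kerPoints_comp_of_isAlgClosed` + ★ `natCard_torsionPoints_eq_of_isAlgClosed`
  + ★ `natCard_kerPoints_fibreHom_quotientMk`).
* §3 `etale_pullback_map_quotientMk_left`, **`etale_toSchemeHom_fibreHom_mulNDesc`** — `ψ_t` and `π_t` are étale when `(n : Ω) ≠ 0`
  (`ψ` is étale ★ `etale_quotientMk_left'` and étaleness is stable under base change; `π_t ≫ ψ_t = [n]_{(A/K)_t}` (★
  `mulNDesc_comp_quotientMk`) is `[n]` of the abelian VARIETY `(A/K)_t` (★ `map_id_pow'`), étale by ★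
  `AbelianVariety.etale_zsmul_id_holds` ([GortzWedhorn2023] Prop. 27.187), so `π_t` is étale by Mathlib `Etale.of_comp`);
  **`finite_and_ncard_mul_natCard_le_pow_geometric`** — `T_t` finite and `#T_t · #K ≤ n^{2g}`: the `hcount` binder of ★
  `hStab_of_level_of_count` at a geometric point of any characteristic (consumed by `PoincarePullbackStabilizerOfLevelGeometric`).

Cell `hodgecm-mathlib` (D-0151), crux hLiu418, line L3 `stub_FROB`/`stub_ROOF0` (RULING «DUAL-B̄» #3, organ H5 at `S = Spec κ̄(w)`).
Count-neutral.  HC_CM is proved only modulo the 7 printed citations until rung 0 closes; nothing here is about HC.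

## References
* [MumfordAV1970] D. Mumford, *Abelian Varieties* (1970), §6 Application 3 (Proposition p. 64), §7 Thm. 4 (p. 72), §12 Thm. 1 (p. 112),
  §15 Thm. 1 (p. 143).
* [MilneAV2008] J. S. Milne, *Abelian Varieties* (v2.00, 2008), I §8 pp. 36–37 (uniqueness in the universal property of the dual).
* [SGA1] A. Grothendieck, *SGA 1*, Exp. V Prop. 2.6 (Galois covers are quotients).
* [GortzWedhorn2023] U. Görtz, T. Wedhorn, *Algebraic Geometry II* (2023), Prop. 27.187 (`[n]` is étale for `n` invertible).
* [GortzWedhorn2020] U. Görtz, T. Wedhorn, *Algebraic Geometry I* (2nd ed., 2020), Section (4.7) (pp. 107–108) (base change).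
* [Lange2023AbelianVarietiesComplex] H. Lange, *Abelian Varieties over the Complex Numbers* (2023), §1.1.2 Prop. 1.1.13 (b) (PDF p. 22).
-/

set_option autoImplicit false

noncomputable section

-- `Scheme.Modules` / `SheafOfModules` are not reducible (as in Mathlib's `AlgebraicGeometry/Modules/Sheaf.lean`);
-- `(A.baseChange t).X = (Over.pullback t).obj A.X` holds by `rfl` only.
set_option backward.isDefEq.respectTransparency false

universe u

open CategoryTheory CategoryTheory.Limits AlgebraicGeometry MonoidalCategory CartesianMonoidalCategory TopologicalSpace Opposite
open scoped MonObj

namespace Literature.AlgebraicGeometry.AbelianSchemes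

namespace AbelianSchemeOver

open Literature.AlgebraicGeometry.Motives Literature.AlgebraicGeometry.AbelianVarieties Literature.AlgebraicGeometry.Modules
  Literature.AlgebraicGeometry.RelativeSpec

/-! ## §1 `#T_t ≤ #ker π_t(Ω)` at a geometric point where `π_t` is an étale isogeny -/

namespace DualPair

variable {S : Scheme.{u}} {X A : AbelianSchemeOver S} (D : A.DualPair) (π : X.X ⟶ A.X) [IsMonHom π]

/-- The underlying scheme morphism of `π_t` is the base change `(π_t).left` (by construction; ★ `toSchemeHom_fibreHom_eq` at any
field-valued point). [cite: GortzWedhorn2020, Section (4.7) (pp. 107–108)] -/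
theorem toSchemeHom_fibreHom_eq_geometric {Ω : Type u} [Field Ω] (t : Spec (.of Ω) ⟶ S) :
    AbelianVariety.Hom.toSchemeHom (fibreHom π t) = (baseChangeHom π t).left := rfl

/-- **`#{b ∈ Â_t(Ω) : (1_X × b)^*N ≅ 𝒪} ≤ #ker π_t(Ω)` at a GEOMETRIC point at which `π_t` is an ÉTALE isogeny** (`N = (π × 1_Â)^*𝒫`,
`Ω` any algebraically closed field) — the injectivity half of [MumfordAV1970] §15 Thm. 1 («`ker π̂ = (ker π)^D`») in the
`FibrePoints` currency of ★ `PoincarePullbackCharOfCount`, characteristic-free twin of ★ `finite_and_ncard_le_natCard_kerPoints`: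
`π_t : X_t → A_t` is a free affine flat geometric quotient by its kernel translations (★
`AbelianVariety.isGeometricQuotient_kerTranslationActionOver_of_etale`, [SGA1] V 2.6 — this is where étaleness is used; ★
`kerTranslationActionOver_free'`), the bundles `𝒫_b`, `b ∈ T_t`, are pairwise non-isomorphic modules on `A_t` (★ point-injectivity of
the dual pair, `eq_of_nonempty_iso` against the 𝒫-slice) trivialised on `X_t`, the kernel translations fix `Γ(X_t, 𝒪) = Ω` (Stein,
★ `appTop_bijective_of_isReduced`), so ★ `finite_and_natCard_le_card_of_forall_iso` applies.
[cite: MumfordAV1970, §15 Thm. 1 (p. 143) and §12 Thm. 1 (p. 112)] [cite: MilneAV2008, I §8 pp. 36–37] [cite: SGA1, Exp. V Prop. 2.6] -/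
theorem finite_and_ncard_le_natCard_kerPoints_of_etale {Ω : Type u} [Field Ω] [IsAlgClosed Ω] (t : Spec (.of Ω) ⟶ S)
    (hπ : AbelianVariety.IsIsogeny (fibreHom π t)) [Etale (AbelianVariety.Hom.toSchemeHom (fibreHom π t))] :
    {b : D.hat.FibrePoints t | Nonempty ((Scheme.Modules.pullback (X.baseChangeToProd D.hat t b.left (Over.w b))).obj
        ((Scheme.Modules.pullback (π ▷ D.hat.X).left).obj D.P) ≅ SheafOfModules.unit _)}.Finite ∧
    {b : D.hat.FibrePoints t | Nonempty ((Scheme.Modules.pullback (X.baseChangeToProd D.hat t b.left (Over.w b))).obj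
        ((Scheme.Modules.pullback (π ▷ D.hat.X).left).obj D.P) ≅ SheafOfModules.unit _)}.ncard ≤
      Nat.card (AbelianVariety.Hom.kerPoints (specOver Ω Ω) (fibreHom π t)) := by
  classical
  set T : Set (D.hat.FibrePoints t) := {b : D.hat.FibrePoints t | Nonempty ((Scheme.Modules.pullback
      (X.baseChangeToProd D.hat t b.left (Over.w b))).obj
        ((Scheme.Modules.pullback (π ▷ D.hat.X).left).obj D.P) ≅ SheafOfModules.unit _)} with hT
  -- the étale isogeny `π_t` as a free affine flat geometric quotient by its kernel translations ([SGA1] V 2.6)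
  set f := fibreHom π t with hf
  haveI : IsFinite (AbelianVariety.Hom.toSchemeHom f) := hπ.2
  haveI : Finite (AbelianVariety.Hom.kerPoints (specOver Ω Ω) f) := AbelianVariety.finite_kerPoints_of_isFinite f Ω
  letI : Fintype (AbelianVariety.Hom.kerPoints (specOver Ω Ω) f) := Fintype.ofFinite _
  have hq := AbelianVariety.isGeometricQuotient_kerTranslationActionOver_of_etale f hπ
  have hfree := AbelianVariety.kerTranslationActionOver_free' f hπ
  haveI : Flat (AbelianVariety.Hom.toSchemeHom f) := hq.flat_of_free hfree
  -- the family of bundles `𝒫_b`, `b ∈ T`, on `A_t`, trivialised on `X_t`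
  let M : T → (pullback A.X.hom t).Modules := fun b => D.pullbackP t b.1.left (Over.w b.1)
  haveI : ∀ b, ((Scheme.Modules.pullback (AbelianVariety.Hom.toSchemeHom f)).obj (M b)).IsQuasicoherent := fun b =>
    isQuasicoherent_of_hasRank (hasRank_pullback _ (hasRank_pullback _ D.hasRank_one))
  haveI : IsIso (C := (pullback X.X.hom t).Modules)
      (SheafOfModules.pullbackObjUnitToUnit (AbelianVariety.Hom.toSchemeHom f).toRingCatSheafHom) := by
    haveI := Literature.AlgebraicGeometry.KTheory.final_opensMap (AbelianVariety.Hom.toSchemeHom f)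
    exact SheafOfModules.instIsIsoPullbackObjUnitToUnitOfFinal _
  have htriv : ∀ b : T, Nonempty ((Scheme.Modules.pullback (AbelianVariety.Hom.toSchemeHom f)).obj (M b) ≅
      SheafOfModules.unit _) := fun b => by
    obtain ⟨j⟩ := b.2
    obtain ⟨e₁⟩ := D.nonempty_pullback_baseChangeToProd_whiskerRight_iso (X := X) π t b.1.left (Over.w b.1)
    exact ⟨e₁.symm ≪≫ j⟩
  let e : ∀ b : T, (Scheme.Modules.pullback (AbelianVariety.Hom.toSchemeHom f)).obj (SheafOfModules.unit _) ≅
      (Scheme.Modules.pullback (AbelianVariety.Hom.toSchemeHom f)).obj (M b) := fun b =>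
    asIso (C := (pullback X.X.hom t).Modules)
      (SheafOfModules.pullbackObjUnitToUnit (AbelianVariety.Hom.toSchemeHom f).toRingCatSheafHom) ≪≫ (htriv b).some.symm
  -- pairwise non-isomorphic: `𝒫_b ≅ 𝒫_{b′} ⟹ b = b′` (uniqueness in the universal property of the dual pair)
  have hinj : ∀ b b' : T, Nonempty (M b ≅ M b') → b = b' := by
    rintro b b' ⟨i⟩
    have h := D.eq_of_nonempty_iso t (D.sliceBundle b'.1.left t (Over.w b'.1)) (D.sliceBundle_fibrewisePicZero _ t _)
      b.1.left b'.1.left (Over.w b.1) (Over.w b'.1) ⟨i⟩ ⟨Iso.refl _⟩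
    exact Subtype.ext (Over.OverMorphism.ext h)
  -- the kernel translations fix the global functions of `X_t` (Stein: they come from `Spec Ω`, through `A_t`)
  have hfix : ∀ (g : AbelianVariety.Hom.kerPoints (specOver Ω Ω) f)
      (b : Γ((X.fibre t).toAbelianVariety.X.left, AbelianVariety.Hom.toSchemeHom f ⁻¹ᵁ ⊤)),
      ((AbelianVariety.kerTranslationActionOver f).aut g).hom.appLE (AbelianVariety.Hom.toSchemeHom f ⁻¹ᵁ ⊤)
        (AbelianVariety.Hom.toSchemeHom f ⁻¹ᵁ ⊤) ((AbelianVariety.kerTranslationActionOver f).preimage_preimage g ⊤).ge b =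
          b := by
    intro g b
    obtain ⟨c, hc⟩ := ((X.baseChange t).appTop_bijective_of_isReduced).2 b
    have hb : b = (AbelianVariety.Hom.toSchemeHom f).app ⊤ ((A.fibre t).toAbelianVariety.X.hom.appTop c) := by
      rw [← hc]
      change ((X.fibre t).toAbelianVariety.X.hom).appTop c = _
      rw [← Over.w f.hom.hom.hom, Scheme.Hom.comp_appTop]
      rfl
    rw [hb]
    exact (AbelianVariety.kerTranslationActionOver f).appLE_aut_app g ⊤ _
  -- `Γ(X_t, 𝒪)` is a domain (`X_t` is integral)
  haveI : IsIntegral (X.fibre t).toAbelianVariety.X.left :=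
    GeometricallyIntegral.isIntegral_of_subsingleton (X.fibre t).toAbelianVariety.X.hom
  haveI : IsDomain Γ((X.fibre t).toAbelianVariety.X.left, AbelianVariety.Hom.toSchemeHom f ⁻¹ᵁ ⊤) :=
    inferInstanceAs (IsDomain Γ((X.fibre t).toAbelianVariety.X.left, ⊤))
  -- count
  obtain ⟨hfin, hcard⟩ := (AbelianVariety.kerTranslationActionOver f).finite_and_natCard_le_card_of_forall_iso hq hfree hfix
    M e hinj
  refine ⟨Set.finite_coe_iff.mp hfin, ?_⟩
  change Nat.card T ≤ _
  exact hcard.trans_eq (Nat.card_eq_fintype_card (α := AbelianVariety.Hom.kerPoints (specOver Ω Ω) f)).symm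

end DualPair

/-! ## §2 `#ker π_t(Ω) · #K = n^{2g}` at a geometric point with `(n : Ω) ≠ 0` -/

section Quotient

variable {S : Scheme.{u}} (A : AbelianSchemeOver S)
  {Y : Scheme.{u}} (u : S ⟶ Y) (K : Subgroup A.Sections) [IsCommMonObj A.X] {n : ℕ}
  (hK : ∀ σ : K, (σ : A.Sections) ^ n = 1)
  [Finite K] [Y.IsSeparated] [IsSeparated (A.X.hom ≫ u)] [S.IsSeparated]
  (hcov : ∀ x : A.left, ∃ O : (A.translationActionOver u K).StableAffineOpens, x ∈ O.1)
  [LocallyOfFiniteType (A.X.hom ≫ u)] [IsLocallyNoetherian Y]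
  (hG : ∃ _ : GrpObj (A.quotientOver u K), IsMonHom (A.quotientMk u K hcov))
  (hsm : Smooth (A.quotientOver u K).hom) (hgc : GeometricallyConnected (A.quotientOver u K).hom)
  [IsAffine Y]
  (hfree : ∀ (Ω : Type u) [Field Ω] [IsAlgClosed Ω] (x : Spec (.of Ω) ⟶ A.left) (σ : K), σ ≠ 1 →
    x ≫ (A.translation (σ : A.Sections)).left ≠ x)

/-- **`#ker π_t(Ω) · #K = n^{2g}` at a geometric point `t`** (`π : A/K → A` the descent of `[n]`, `A/S` of relative dimension `g`,
`Ω` algebraically closed with `(n : Ω) ≠ 0`): `ψ_t ≫ π_t = [n]_{A_t}` with `ψ_t` an isogeny, so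
`#ker ψ_t · #ker π_t = #A_t[n](Ω) = n^{2g}` (★ `IsIsogeny.natCard_kerPoints_comp_of_isAlgClosed`; [MumfordAV1970] §6 App. 3, ★
`natCard_torsionPoints_eq_of_isAlgClosed`), and `#ker ψ_t = #K` (★ `natCard_kerPoints_fibreHom_quotientMk`).  The ★ complex
`natCard_kerPoints_fibreHom_mulNDesc_mul_natCard` at any geometric point of any characteristic. [cite: MumfordAV1970, §7 Thm. 4 (p. 72)]
[cite: MumfordAV1970, §6 Application 3 (Proposition p. 64)] [cite: Lange2023AbelianVarietiesComplex, §1.1.2 Prop. 1.1.13 (b) (PDF p. 22)] -/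
theorem natCard_kerPoints_fibreHom_mulNDesc_mul_natCard_geometric {g : ℕ} (hA : A.IsOfRelDim g) {Ω : Type u} [Field Ω]
    [IsAlgClosed Ω] (t : Spec (.of Ω) ⟶ S) (hn : (n : Ω) ≠ 0) :
    haveI := A.isMonHom_mulNDesc u K hK hcov hG hsm hgc hfree
    Nat.card (AbelianVariety.Hom.kerPoints (specOver Ω Ω)
        (fibreHom (A := A.quotientBy u K hcov hG hsm hgc) (B := A) (A.mulNDesc u K hK hcov) t)) * Nat.card K =
      n ^ (2 * g) := by
  letI : GrpObj (A.quotientOver u K) := (A.quotientBy u K hcov hG hsm hgc).grpObj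
  haveI := A.isMonHom_quotientMk u K hcov hG hsm hgc
  haveI := A.isMonHom_mulNDesc u K hK hcov hG hsm hgc hfree
  have hn' : ((n : ℤ) : Ω) ≠ 0 := by rwa [Int.cast_natCast]
  obtain ⟨hψ, -⟩ := A.isIsogeny_fibreHom_quotientMk_and_mulNDesc u K hK hcov hG hsm hgc hfree hA t hn
  have h1 := hψ.natCard_kerPoints_comp_of_isAlgClosed
    (fibreHom (A := A.quotientBy u K hcov hG hsm hgc) (B := A) (A.mulNDesc u K hK hcov) t)
  rw [A.fibreHom_quotientMk_comp_fibreHom_mulNDesc u K hK hcov hG hsm hgc hfree t,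
    ← AbelianVariety.torsionPoints_eq_kerPoints,
    (A.fibre t).toAbelianVariety.natCard_torsionPoints_eq_of_isAlgClosed Ω (n : ℤ) hn', Int.natAbs_natCast,
    dim_fibre_of_isOfRelDim hA t, A.natCard_kerPoints_fibreHom_quotientMk u K hcov hG hsm hgc hfree t] at h1
  rw [h1, Nat.mul_comm]

/-! ## §3 `ψ_t`, `π_t` are étale for `(n : Ω) ≠ 0`; the count `#T_t · #K ≤ n^{2g}` -/

omit [IsCommMonObj A.X] in
/-- **`ψ_t : A_t → (A/K)_t` is étale** at every field-valued point `t` (`ψ` is étale, ★ `etale_quotientMk_left'`; base change along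
`A_t → A`, ★ `Limits.isPullback_pullback_map_left`). [cite: SGA1, Exp. V Cor. 2.4, Prop. 2.6] [cite: GortzWedhorn2020, Section (4.7) (pp. 107–108)] -/
theorem etale_pullback_map_quotientMk_left
    (hfree : ∀ (Ω : Type u) [Field Ω] [IsAlgClosed Ω] (x : Spec (.of Ω) ⟶ A.left) (σ : K), σ ≠ 1 →
      x ≫ (A.translation (σ : A.Sections)).left ≠ x) {Ω : Type u} [Field Ω] (t : Spec (.of Ω) ⟶ S) :
    Etale ((Over.pullback t).map
      (show A.X ⟶ (A.quotientBy u K hcov hG hsm hgc).X from A.quotientMk u K hcov)).left := by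
  haveI := A.etale_quotientMk_left' u K hcov hG hsm hgc hfree
  exact MorphismProperty.of_isPullback (P := @Etale)
    (Literature.AlgebraicGeometry.Limits.isPullback_pullback_map_left t
      (show A.X ⟶ (A.quotientBy u K hcov hG hsm hgc).X from A.quotientMk u K hcov)).flip inferInstance

/-- **`π_t : (A/K)_t → A_t` is ÉTALE at a field-valued point `t` with `(n : Ω) ≠ 0`**: `π_t ≫ ψ_t = ([n]_{A/K})_t` (★
`mulNDesc_comp_quotientMk`, functoriality of base change) is `[n]` of the abelian VARIETY `(A/K)_t` (★ `map_id_pow'`), which is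
étale (★ `AbelianVariety.etale_zsmul_id_holds`, [GortzWedhorn2023] Prop. 27.187), and `ψ_t` is étale (hence unramified and locally of
finite type), so `π_t` is étale (Mathlib `Etale.of_comp`). [cite: GortzWedhorn2023, Prop. 27.187] [cite: MumfordAV1970, §7 Thm. 4 (p. 72)] -/
theorem etale_toSchemeHom_fibreHom_mulNDesc {Ω : Type u} [Field Ω] (t : Spec (.of Ω) ⟶ S) (hn : (n : Ω) ≠ 0) :
    haveI := A.isMonHom_mulNDesc u K hK hcov hG hsm hgc hfree
    Etale (AbelianVariety.Hom.toSchemeHom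
      (fibreHom (A := A.quotientBy u K hcov hG hsm hgc) (B := A) (A.mulNDesc u K hK hcov) t)) := by
  letI : GrpObj (A.quotientOver u K) := (A.quotientBy u K hcov hG hsm hgc).grpObj
  haveI := A.isMonHom_mulNDesc u K hK hcov hG hsm hgc hfree
  set ψ : A.X ⟶ (A.quotientBy u K hcov hG hsm hgc).X := A.quotientMk u K hcov with hψ
  haveI : Etale ((Over.pullback t).map ψ).left := A.etale_pullback_map_quotientMk_left u K hcov hG hsm hgc hfree t
  -- `[n]` of the abelian variety `(A/K)_t` is étale
  have hn' : ((n : ℤ) : Ω) ≠ 0 := by rwa [Int.cast_natCast]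
  have het := AbelianVariety.etale_zsmul_id_holds (A := ((A.quotientBy u K hcov hG hsm hgc).fibre t).toAbelianVariety) (n : ℤ) hn'
  have e1 : AbelianVariety.Hom.toSchemeHom ((n : ℤ) • 𝟙 ((A.quotientBy u K hcov hG hsm hgc).fibre t).toAbelianVariety) =
      ((Over.pullback t).map ((𝟙 (A.quotientBy u K hcov hG hsm hgc).X : _ ⟶ _) ^ n)).left := by
    change (((n : ℤ) • 𝟙 ((A.quotientBy u K hcov hG hsm hgc).fibre t).toAbelianVariety).hom.hom.hom).left = _
    rw [AbelianVariety.hom_zsmul_id, zpow_natCast, map_id_pow']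
    rfl
  rw [e1] at het
  -- `π_t ≫ ψ_t = ([n]_{A/K})_t`
  have hcomp : AbelianVariety.Hom.toSchemeHom
        (fibreHom (A := A.quotientBy u K hcov hG hsm hgc) (B := A) (A.mulNDesc u K hK hcov) t) ≫
      ((Over.pullback t).map ψ).left =
        ((Over.pullback t).map ((𝟙 (A.quotientBy u K hcov hG hsm hgc).X : _ ⟶ _) ^ n)).left := by
    change ((Over.pullback t).map (A.mulNDesc u K hK hcov)).left ≫ ((Over.pullback t).map ψ).left = _
    rw [← Over.comp_left, ← Functor.map_comp, hψ, A.mulNDesc_comp_quotientMk u K hK hcov hG hsm hgc hfree, mulN_def]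
  haveI : Etale (AbelianVariety.Hom.toSchemeHom
        (fibreHom (A := A.quotientBy u K hcov hG hsm hgc) (B := A) (A.mulNDesc u K hK hcov) t) ≫
      ((Over.pullback t).map ψ).left) := by
    rw [hcomp]; exact het
  exact Etale.of_comp _ ((Over.pullback t).map ψ).left

variable (D : A.DualPair)

/-- **`#T_t · #K ≤ n^{2g}` at a GEOMETRIC point — the `hcount` input of ★ `hStab_of_level_of_count` in any characteristic**, for
`A/S` of relative dimension `g` over a reduced locally Noetherian base, `Ω` algebraically closed with `(n : Ω) ≠ 0`, at
`t : Spec Ω → S`: the set `T_t = {b ∈ Â_t(Ω) | (1_{A/K} × b)^*𝒩₁ ≅ 𝒪}` (`𝒩₁ = (π × 1)^*𝒫`) is finite with `#T_t ≤ #ker π_t(Ω)`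
([MumfordAV1970] §15 Thm. 1, §1 `finite_and_ncard_le_natCard_kerPoints_of_etale` — `π_t` an étale isogeny by ★
`isIsogeny_fibreHom_quotientMk_and_mulNDesc` and `etale_toSchemeHom_fibreHom_mulNDesc`) and `#ker π_t(Ω) · #K = n^{2g}` (§2).  The ★
complex `finite_and_ncard_mul_natCard_le_pow` at any geometric point. [cite: MumfordAV1970, §15 Thm. 1 (p. 143)]
[cite: MumfordAV1970, §7 Thm. 4 (p. 72)] -/
theorem finite_and_ncard_mul_natCard_le_pow_geometric [IsReduced S] [IsLocallyNoetherian S] {g : ℕ} (hA : A.IsOfRelDim g)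
    {Ω : Type u} [Field Ω] [IsAlgClosed Ω] (t : Spec (.of Ω) ⟶ S) (hn : (n : Ω) ≠ 0) :
    {b : D.hat.FibrePoints t | Nonempty ((Scheme.Modules.pullback
        ((A.quotientBy u K hcov hG hsm hgc).baseChangeToProd D.hat t b.left (Over.w b))).obj
        (A.poincarePullbackBundle u K hK hcov hG hsm hgc D hfree).L ≅ SheafOfModules.unit _)}.Finite ∧
      {b : D.hat.FibrePoints t | Nonempty ((Scheme.Modules.pullback
          ((A.quotientBy u K hcov hG hsm hgc).baseChangeToProd D.hat t b.left (Over.w b))).obj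
          (A.poincarePullbackBundle u K hK hcov hG hsm hgc D hfree).L ≅ SheafOfModules.unit _)}.ncard * Nat.card K ≤
        n ^ (2 * g) := by
  letI : GrpObj (A.quotientOver u K) := (A.quotientBy u K hcov hG hsm hgc).grpObj
  haveI := A.isMonHom_mulNDesc u K hK hcov hG hsm hgc hfree
  obtain ⟨-, hπ⟩ := A.isIsogeny_fibreHom_quotientMk_and_mulNDesc u K hK hcov hG hsm hgc hfree hA t hn
  haveI := A.etale_toSchemeHom_fibreHom_mulNDesc u K hK hcov hG hsm hgc hfree t hn
  obtain ⟨hfin, hle⟩ := DualPair.finite_and_ncard_le_natCard_kerPoints_of_etale (X := A.quotientBy u K hcov hG hsm hgc) D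
    (A.mulNDesc u K hK hcov) t hπ
  refine ⟨hfin, ?_⟩
  rw [← A.natCard_kerPoints_fibreHom_mulNDesc_mul_natCard_geometric u K hK hcov hG hsm hgc hfree hA t hn]
  exact Nat.mul_le_mul_right _ hle

end Quotient

end AbelianSchemeOver

end Literature.AlgebraicGeometry.AbelianSchemes

end
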